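import Summits.ABC.IUTFork.Thm311RealInd1StripGlobalStrictnessDyadicWitness
import HarnessLib

/-!
# Row «C:PSI5-G1-INDTWO-SWAP» (R39, C LEAD ruling C-R223): desk guard G1 of C-R219/C-R221 DECIDED IN THE KERNEL, NEGATIVELY AS TYPED — the isolated
# instance «H ≡ indTwo itself, acting factorwise» of R36 (ψ5) is EMPTY: OUR typed full (Ind2) `indTwo` at a packet with two equal factors of local
# degree ≥ 2 contains the FACTOR SWAP, which preserves `log_p(R_I^×)` and is not factorwise; at the R38 Gaussian input this is EVERY `(i₁, e₁)`

Proof-only file of the abc-iut cell (guard-decision row on R36 (ψ5) ★ p606976 / R38 ★ p617014 / R38b ★ p617696, whose bytes and RQ7 legs are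
untouched; executed by the live seat abc-iut-f-193 GEN 36 under GO-by-ruling C-R223).  Statements about OUR typed packets, OUR `indTwo` and OUR
hypothesis shape `hHfac` only; empty-binder ≠ refuted; calibrated ≠ discharged; typed ≠ proved; it neither says print's (Ind2) is wrong nor that
(ψ5) is wrong; TAKES NO SIDE on [IUTchIII] Cor. 3.12 / Thm. 3.11 (Ind2) / [IUTchIV] Thm. 1.10, on reading (U) vs (P), or on any author; NO abc claim.

WHY.  R36 (ψ5) `ThetaVolumeInput.sum_lnνLp_hull_orbitH_ne_negLogThetaPerImageNonarch_of_dyadicSqrtNegOne` is a ∀-statement over prime-indexed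
families `H ≤ indTwo` carrying, at ONE dyadic collection `(i₁, e₁)`, the hypothesis `hHfac`: every `γ ∈ H_{2,i₁+1,e₁}` acts on pure tensors
FACTORWISE, `γ(⊗_b z_b) = ⊗_b of(δ_b(of⁻¹ z_b))`, through additive automorphisms `δ_b` in the closure of the realised (Ind1) strip part.  R38
inhabited the binder class with `H ≡ ⊥`, R38b with the strip-moves family `H⋆ ≤ indTwo`; the C LEAD's desk guard G1 recorded «`indTwo` itself not
exhibited».  Here G1 is decided: `indTwo p k = Aut_{ℚ_p}(⊗_b K_w ; log_p(R_I^×))` (abc-iut-S2's `TensorPacketShell`, Dupuy–Hilado §4.9) is the FULL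
lattice stabiliser; over a CONSTANT collection `e₁ ≡ w` with `≥ 2` factors it contains the factor swap `PiTensorProduct.reindex ℚ_p (fun _ ↦ K_w)
(Equiv.swap 0 1)` (§1 `swap_mem_indTwo`, from `mem_indTwo_iff` BY NAME: the swap permutes the generating pure tensors `⊗ z_b`, `z_b ∈ log_p(O^×)`, of
`logPacket`), and the swap is NOT of the factorwise shape `γ(⊗ z_b) = ⊗ F_b(z_b)` for ANY functions `F_b : K_w → K_w` as soon as `[K_w : ℚ_p] ≥ 2`
(§1 `swap_not_factorwise`: coordinate functionals `λ, μ` of a basis `u, t, …` and the linear functionals `Λ_a(⊗ z_b) = ∏_b a_b(z_b)` give, from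
`z ≡ u`, `λ(F₀u)·∏_{b≥1}λ(F_b u) = 1` and `μ(F₀u)·∏_{b≥1}λ(F_b u) = 0`, hence `μ(F₀u) = 0`, while `z = (u,t,u,…)` gives `1 = μ(F₀u)·(…) = 0`).
Hence (§2 `not_hHfac_indTwo_of_two_le_localDeg`) for EVERY genuine Θ-volume input `I : ThetaVolumeInput F₀ K`, every `i₁` and every CONSTANT dyadic
collection `e₁` whose section place has local degree `≥ 2` — THIS HYPOTHESIS IS CARRIED (`hd : 2 ≤ localDeg K (I.σ.lift (e₁ 0))`); at a dyadic place of
local degree `1` the packet is a tensor product of LINES, the swap IS factorwise, and NOTHING is claimed there — (ψ5)'s `hHfac`, COPIED VERBATIM with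
`H 2 _ (i₁+1) e₁ := indTwo 2 (fun b ↦ (I.σ.localFields 2).k (e₁ b))`, is FALSE (some `γ` admits no `δ` at all, let alone one in the strip closure); and
(§3 `exists_input_not_hHfac_indTwo_gaussian`) BY NAME at R38 §1's Gaussian witness over `ℚ(√−1) = CyclotomicField 4 ℚ` (every place over `2` of
local degree `2`) at EVERY `(i₁, e₁)` — every dyadic collection there is constant, `ℚ(√−1)` having ONE place over `2` (§3
`placesOver_two_eq_of_finrank_two_of_sq_eq_neg_one`, from abc-iut-E-t47's `e = 2, f = 1` and the fundamental identity `sum_localDeg`).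

READING (numbers about OUR typed objects; neutral).  The binder class of R36 (ψ5) at `H ≡ indTwo` is EMPTY AS TYPED at every dyadic packet with two
equal factors of local degree `≥ 2`; (ψ5) is CALIBRATED on FACTORWISE sub-families of (Ind2) only (`⊥` R38 · strip-moves `H⋆` R38b · any `H ≤ indTwo`
satisfying `hHfac`); OUR typed full (Ind2) `= indTwo` lies OUTSIDE its binder class — a TYPED GAP of the strictness instrument, NOT treated here (a
re-typing of (ψ5) with a non-factorwise compatibility hypothesis would be a different statement).  DISCHARGES NOTHING, REFUTES NOTHING: (ψ5) / R38 /
R38b stand byte-identical; RESHAPE-4, `stub_cor312PerImage`, `ThetaPartII` untouched.  NOT treated: non-constant collections over fields with several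
places over `2` (the swap is not available as typed between distinct factor types).

[cite: DupuyHilado2025, §4.9 (Ind2), Def. 3.6.1, Def. 3.6.3] [cite: Mochizuki2012, IUTchIII Thm. 3.11 (i) (Ind1)(Ind2) p. 154; IUTchIV Prop. 1.2 p. 10]
[cite: NeukirchANT1999, Ch. I Prop. (8.2), Ch. II Prop. (6.8)] [claim: Mochizuki2012, status: disputed] for every IUT quotation.  PROOF-ONLY: no definition,
no instance, no notation, no attribute, no `Prop` fact; the swap and the functionals are Mathlib terms written inline.
-/

set_option autoImplicit false

noncomputable section

open Metric Set Function Module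
open scoped Pointwise TensorProduct

namespace Literature.IUT.LogVolume

/-! ## §1 Packet level: factor permutations lie in (Ind2) `indTwo`; the factor swap is not factorwise -/

namespace IndTwoSwap

variable (p : ℕ) [Fact p.Prime] (k₀ : Type) [NontriviallyNormedField k₀] [NormedAlgebra ℚ_[p] k₀]

/-- Re-indexing the factors of `⊗_{b ∈ ι} K_w` (constant family) along any `e : ι ≃ ι` maps `log_p(R_I^×) = logPacket` INTO itself: it permutes
the generating pure tensors `⊗_b z_b`, `z_b ∈ log_p(O_w^×)`. [cite: DupuyHilado2025, §4.9] [cite: Mochizuki2012, IUTchIV Prop. 1.2 p. 10] -/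
theorem reindex_mem_logPacket {ι : Type} (e : ι ≃ ι) {x : PacketAlgebra p (fun _ : ι => k₀)}
    (hx : x ∈ logPacket p (fun _ : ι => k₀)) :
    PiTensorProduct.reindex ℚ_[p] (fun _ : ι => k₀) e x ∈ logPacket p (fun _ : ι => k₀) := by
  unfold logPacket at hx ⊢
  refine AddSubgroup.closure_induction (fun y hy => ?_) ?_ (fun y y' _ _ hy hy' => ?_) (fun y _ hy => ?_) hx
  · obtain ⟨z, hz, rfl⟩ := hy
    refine AddSubgroup.subset_closure ⟨fun i => z (e.symm i), fun i => hz (e.symm i), ?_⟩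
    simp only [purePacket, PiTensorProduct.reindex_tprod]
  · rw [map_zero]
    exact AddSubgroup.zero_mem _
  · rw [map_add]
    exact AddSubgroup.add_mem _ hy hy'
  · rw [map_neg]
    exact AddSubgroup.neg_mem _ hy

/-- **Factor permutations belong to (Ind2).**  For every `e : ι ≃ ι`, the re-indexing automorphism `⊗_b z_b ↦ ⊗_b z_{e⁻¹ b}` of the packet algebra
`⊗_{b ∈ ι} K_w` lies in `indTwo = Aut_{ℚ_p}(V ; log_p(R_I^×))`. [cite: DupuyHilado2025, §4.9] [cite: Mochizuki2012, IUTchIV Prop. 1.2 p. 10] -/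
theorem reindex_mem_indTwo {ι : Type} (e : ι ≃ ι) :
    PiTensorProduct.reindex ℚ_[p] (fun _ : ι => k₀) e ∈ indTwo p (fun _ : ι => k₀) := by
  rw [mem_indTwo_iff]
  intro x
  constructor
  · intro hx
    have h := reindex_mem_logPacket p k₀ e.symm hx
    rwa [← PiTensorProduct.reindex_symm, LinearEquiv.symm_apply_apply] at h
  · exact reindex_mem_logPacket p k₀ e

/-- **The factor swap belongs to (Ind2)**: the swap of the factors `0` and `1` of `⊗_{b ∈ Fin (n+2)} K_w` lies in `indTwo` (`mem_indTwo_iff` BY NAME,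
through `reindex_mem_indTwo`). [cite: DupuyHilado2025, §4.9] [cite: Mochizuki2012, IUTchIV Prop. 1.2 p. 10] -/
theorem swap_mem_indTwo (n : ℕ) :
    PiTensorProduct.reindex ℚ_[p] (fun _ : Fin (n + 2) => k₀) (Equiv.swap (0 : Fin (n + 2)) 1) ∈ indTwo p (fun _ : Fin (n + 2) => k₀) :=
  reindex_mem_indTwo p k₀ _

/-- The linear functional `Λ_a := lift(∏_b a_b)` evaluates on pure tensors as `Λ_a(⊗_b z_b) = ∏_b a_b(z_b)`. [folklore] -/
theorem lift_mkPiAlgebra_compLinearMap_tprod {ι : Type} [Fintype ι] (a : ι → (k₀ →ₗ[ℚ_[p]] ℚ_[p])) (z : ι → k₀) :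
    PiTensorProduct.lift ((MultilinearMap.mkPiAlgebra ℚ_[p] ι ℚ_[p]).compLinearMap a) (PiTensorProduct.tprod ℚ_[p] z) =
      ∏ i, a i (z i) := by
  rw [PiTensorProduct.lift.tprod, MultilinearMap.compLinearMap_apply, MultilinearMap.mkPiAlgebra_apply]

/-- **The factor swap is NOT factorwise.**  If `[K_w : ℚ_p] ≥ 2`, then for NO family of functions `F_b : K_w → K_w` (`b ∈ Fin (n+2)`) does the swap of
the factors `0` and `1` of `⊗_{b ∈ Fin (n+2)} K_w` act as `⊗_b z_b ↦ ⊗_b F_b(z_b)` on all pure tensors.  (Coordinate functionals `λ = u^*`, `μ = t^*`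
of a basis `u, t, …`; `Λ_{(λ,λ,…)}` and `Λ_{(μ,λ,λ,…)}` at `z ≡ u` give `μ(F₀u) = 0`, and `Λ_{(μ,λ,…)}` at `z = (u,t,u,…)` gives `1 = 0`.) [folklore] -/
theorem swap_not_factorwise (h2 : 2 ≤ Module.finrank ℚ_[p] k₀) (n : ℕ) (F : Fin (n + 2) → k₀ → k₀) :
    ¬ ∀ z : Fin (n + 2) → k₀,
      PiTensorProduct.reindex ℚ_[p] (fun _ : Fin (n + 2) => k₀) (Equiv.swap (0 : Fin (n + 2)) 1) (PiTensorProduct.tprod ℚ_[p] z) =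
        PiTensorProduct.tprod ℚ_[p] (fun b => F b (z b)) := by
  intro hfac
  haveI : Module.Finite ℚ_[p] k₀ := Module.finite_of_finrank_pos (by omega)
  -- a basis `u = β i₀, t = β i₁, …` and its coordinate functionals `λ, μ`
  let β := Module.finBasis ℚ_[p] k₀
  let i₀ : Fin (Module.finrank ℚ_[p] k₀) := ⟨0, by omega⟩
  let i₁ : Fin (Module.finrank ℚ_[p] k₀) := ⟨1, by omega⟩
  have h01 : i₀ ≠ i₁ := fun h => by simp [i₀, i₁, Fin.ext_iff] at h
  let u : k₀ := β i₀
  let t : k₀ := β i₁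
  let lam : k₀ →ₗ[ℚ_[p]] ℚ_[p] := β.coord i₀
  let mu : k₀ →ₗ[ℚ_[p]] ℚ_[p] := β.coord i₁
  have hlu : lam u = 1 := by simp [lam, u, Basis.coord_apply, Basis.repr_self]
  have hmu : mu u = 0 := by simp [mu, u, Basis.coord_apply, Basis.repr_self, h01]
  have hmt : mu t = 1 := by simp [mu, t, Basis.coord_apply, Basis.repr_self]
  -- the two functionals `Λ_{(λ,λ,…)}` and `Λ_{(μ,λ,λ,…)}`
  let a₁ : Fin (n + 2) → (k₀ →ₗ[ℚ_[p]] ℚ_[p]) := fun _ => lam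
  let a₂ : Fin (n + 2) → (k₀ →ₗ[ℚ_[p]] ℚ_[p]) := Fin.cons mu (fun _ : Fin (n + 1) => lam)
  let Λ₁ : PacketAlgebra p (fun _ : Fin (n + 2) => k₀) →ₗ[ℚ_[p]] ℚ_[p] :=
    PiTensorProduct.lift ((MultilinearMap.mkPiAlgebra ℚ_[p] (Fin (n + 2)) ℚ_[p]).compLinearMap a₁)
  let Λ₂ : PacketAlgebra p (fun _ : Fin (n + 2) => k₀) →ₗ[ℚ_[p]] ℚ_[p] :=
    PiTensorProduct.lift ((MultilinearMap.mkPiAlgebra ℚ_[p] (Fin (n + 2)) ℚ_[p]).compLinearMap a₂)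
  -- the two test vectors `z₁ ≡ u` and `z₂ = (u, t, u, …)`; the swap fixes `⊗ z₁` and sends `⊗ z₂` to `⊗ (t, u, u, …)`
  let z₁ : Fin (n + 2) → k₀ := fun _ => u
  let z₂ : Fin (n + 2) → k₀ := Fin.cons u (Fin.cons t (fun _ : Fin n => u))
  have hz₂0 : z₂ (Equiv.swap (0 : Fin (n + 2)) 1 0) = t := by
    rw [Equiv.swap_apply_left]
    rfl
  have hz₂s : ∀ i : Fin (n + 1), z₂ (Equiv.swap (0 : Fin (n + 2)) 1 i.succ) = u := by
    intro i
    refine Fin.cases ?_ (fun j => ?_) i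
    · rw [show (Fin.succ (0 : Fin (n + 1)) : Fin (n + 2)) = 1 from rfl, Equiv.swap_apply_right]
      rfl
    · rw [Equiv.swap_apply_of_ne_of_ne (Fin.succ_ne_zero _) (by
          rw [show (1 : Fin (n + 2)) = Fin.succ 0 from rfl]
          exact fun h => Fin.succ_ne_zero j (Fin.succ_injective _ h))]
      rfl
  -- (eq1) `Λ₁` at `z₁`: `1 = λ(F₀u) · ∏_{b≥1} λ(F_b u)`
  have e1 := congrArg Λ₁ (hfac z₁)
  have e1' : (1 : ℚ_[p]) = lam (F 0 u) * ∏ i : Fin (n + 1), lam (F i.succ u) := by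
    have hL : Λ₁ (PiTensorProduct.reindex ℚ_[p] (fun _ : Fin (n + 2) => k₀) (Equiv.swap (0 : Fin (n + 2)) 1)
        (PiTensorProduct.tprod ℚ_[p] z₁)) = 1 := by
      rw [PiTensorProduct.reindex_tprod]
      simp only [Λ₁, lift_mkPiAlgebra_compLinearMap_tprod, a₁, z₁, hlu, Finset.prod_const_one]
    have hR : Λ₁ (PiTensorProduct.tprod ℚ_[p] (fun b => F b (z₁ b))) = lam (F 0 u) * ∏ i : Fin (n + 1), lam (F i.succ u) := by
      simp only [Λ₁, lift_mkPiAlgebra_compLinearMap_tprod, a₁, z₁, Fin.prod_univ_succ]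
    rw [← hL, e1, hR]
  -- (eq2) `Λ₂` at `z₁`: `0 = μ(F₀u) · ∏_{b≥1} λ(F_b u)`
  have e2 := congrArg Λ₂ (hfac z₁)
  have e2' : (0 : ℚ_[p]) = mu (F 0 u) * ∏ i : Fin (n + 1), lam (F i.succ u) := by
    have hL : Λ₂ (PiTensorProduct.reindex ℚ_[p] (fun _ : Fin (n + 2) => k₀) (Equiv.swap (0 : Fin (n + 2)) 1)
        (PiTensorProduct.tprod ℚ_[p] z₁)) = 0 := by
      rw [PiTensorProduct.reindex_tprod]
      simp only [Λ₂, lift_mkPiAlgebra_compLinearMap_tprod, a₂, z₁, Fin.prod_univ_succ, Fin.cons_zero, hmu, zero_mul]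
    have hR : Λ₂ (PiTensorProduct.tprod ℚ_[p] (fun b => F b (z₁ b))) = mu (F 0 u) * ∏ i : Fin (n + 1), lam (F i.succ u) := by
      simp only [Λ₂, lift_mkPiAlgebra_compLinearMap_tprod, a₂, z₁, Fin.prod_univ_succ, Fin.cons_zero, Fin.cons_succ]
    rw [← hL, e2, hR]
  -- (eq3) `Λ₂` at `z₂`: `1 = μ(F₀u) · (λ(F₁t) · ∏_{b≥2} λ(F_b u))`
  have e3 := congrArg Λ₂ (hfac z₂)
  have e3' : (1 : ℚ_[p]) = mu (F 0 u) * ∏ i : Fin (n + 1), lam (F i.succ (z₂ i.succ)) := by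
    have hL : Λ₂ (PiTensorProduct.reindex ℚ_[p] (fun _ : Fin (n + 2) => k₀) (Equiv.swap (0 : Fin (n + 2)) 1)
        (PiTensorProduct.tprod ℚ_[p] z₂)) = 1 := by
      rw [PiTensorProduct.reindex_tprod, Equiv.symm_swap]
      simp only [Λ₂, lift_mkPiAlgebra_compLinearMap_tprod, a₂, Fin.prod_univ_succ, Fin.cons_zero, Fin.cons_succ, hz₂0, hz₂s, hmt, hlu,
        Finset.prod_const_one, mul_one]
    have hR : Λ₂ (PiTensorProduct.tprod ℚ_[p] (fun b => F b (z₂ b))) = mu (F 0 u) * ∏ i : Fin (n + 1), lam (F i.succ (z₂ i.succ)) := by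
      simp only [Λ₂, lift_mkPiAlgebra_compLinearMap_tprod, a₂, Fin.prod_univ_succ, Fin.cons_zero, Fin.cons_succ]
      rfl
    rw [← hL, e3, hR]
  -- `∏_{b≥1} λ(F_b u) ≠ 0` by (eq1), so `μ(F₀u) = 0` by (eq2), and (eq3) reads `1 = 0`
  have hP : ∏ i : Fin (n + 1), lam (F i.succ u) ≠ 0 := by
    intro h0
    rw [h0, mul_zero] at e1'
    exact one_ne_zero e1'
  have hmu0 : mu (F 0 u) = 0 := by
    rcases mul_eq_zero.mp e2'.symm with h | h
    · exact h
    · exact absurd h hP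
  rw [hmu0, zero_mul] at e3'
  exact one_ne_zero e3'

/-- **(Ind2) `indTwo` does not act factorwise** on `⊗_{b ∈ Fin (n+2)} K_w` when `[K_w : ℚ_p] ≥ 2`: it has a member `γ` (the factor swap) such that
for NO functions `F_b : K_w → K_w` is `γ(⊗_b z_b) = ⊗_b F_b(z_b)` for all `z`. [cite: DupuyHilado2025, §4.9] [cite: Mochizuki2012, IUTchIV Prop. 1.2 p. 10] -/
theorem exists_mem_indTwo_not_factorwise (h2 : 2 ≤ Module.finrank ℚ_[p] k₀) (n : ℕ) :
    ∃ γ ∈ indTwo p (fun _ : Fin (n + 2) => k₀), ∀ F : Fin (n + 2) → k₀ → k₀,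
      ¬ ∀ z : Fin (n + 2) → k₀, γ (PiTensorProduct.tprod ℚ_[p] z) = PiTensorProduct.tprod ℚ_[p] (fun b => F b (z b)) :=
  ⟨_, swap_mem_indTwo p k₀ n, swap_not_factorwise p k₀ h2 n⟩

end IndTwoSwap

/-! ## §2 Input level: (ψ5)'s `hHfac` is unsatisfiable at `H ≡ indTwo` over every constant dyadic collection of local degree `≥ 2` -/

namespace ThetaVolumeInput

open Summit.ABC.IUTFork.Thm311.Real Literature.NumberTheory.NumberFields Function
open Literature.NumberTheory.GaloisRepresentations Literature.NumberTheory.GaloisRepresentations.Ultrametric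
open Literature.AnabelianGeometry.AbsoluteAnabelian Literature.IUT.HodgeArakelov
open Literature.IUT.HodgeArakelov.AbsTopMonoids NumberField IsDedekindDomain

variable {F₀ : Type} [Field F₀] [NumberField F₀] {K : Type} [Field K] [NumberField K] [Algebra F₀ K]
variable (I : ThetaVolumeInput F₀ K)

namespace IndTwoSwap

/-- **At a genuine input, (Ind2) over a constant collection is not factorwise.**  For every genuine Θ-volume input `I`, every prime `p`, every
`w ∈ V(F₀)_p` whose section place `w̲ = I.σ.lift w` has local degree `[K_{w̲} : ℚ_p] ≥ 2` (HYPOTHESIS `hd`; at a place of local degree `1` the packet is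
a tensor product of LINES and the swap IS factorwise — nothing is claimed there), and every `n`: `indTwo` at the constant collection `v⃗ ≡ w` of length
`n + 2` has a member acting NON-factorwise on pure tensors (no functions `F_b : K_{w̲} → K_{w̲}` whatsoever). [cite: DupuyHilado2025, §4.9, Def. 3.6.1]
[cite: NeukirchANT1999, Ch. II Prop. (6.8)] -/
theorem exists_mem_indTwo_const_not_factorwise (p : ℕ) [Fact p.Prime] (w : placesOver F₀ p) (hd : 2 ≤ localDeg K (I.σ.lift w.1)) (n : ℕ) :
    ∃ γ ∈ indTwo p (fun _ : Fin (n + 2) => (I.σ.localFields p).k w), ∀ F : Fin (n + 2) → (I.σ.localFields p).k w → (I.σ.localFields p).k w,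
      ¬ ∀ z : Fin (n + 2) → (I.σ.localFields p).k w,
        γ (PiTensorProduct.tprod ℚ_[p] z) = PiTensorProduct.tprod ℚ_[p] (fun b => F b (z b)) :=
  Literature.IUT.LogVolume.IndTwoSwap.exists_mem_indTwo_not_factorwise p ((I.σ.localFields p).k w)
    (by rw [PlaceSection.finrank_localFields_k]; exact hd) n

/-- **(ψ5)'s `hHfac` FAILS at `H ≡ indTwo` (desk guard G1 decided negatively, AS TYPED).**  For every genuine Θ-volume input `I : ThetaVolumeInput F₀ K`,
every procession index `i₁`, every CONSTANT dyadic collection `e₁` (`e₁ b = e₁ 0` for all `b`) whose section place has local degree `[K_{e̲₁0} : ℚ₂] ≥ 2`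
(HYPOTHESIS `hd`; for local degree `1` nothing is claimed): the NEGATION of R36 (ψ5)'s hypothesis `hHfac` — COPIED VERBATIM from
`sum_lnνLp_hull_orbitH_ne_negLogThetaPerImageNonarch_of_dyadicSqrtNegOne` (same `δ`-type, same `AddSubgroup.closure` of `ind1StripOf`, same
`RescaledCompletion.of` conjugation, same `PiTensorProduct.tprod` shape) with the family instantiated at print's full (Ind2):
`H 2 Nat.prime_two ((i₁ : ℕ) + 1) e₁ := indTwo 2 (fun b ↦ (I.σ.localFields 2).k (e₁ b))` (the right-hand side of (ψ5)'s `hH` at `p = 2`, `e = e₁`).  Indeed some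
`γ ∈ indTwo` there — the factor swap — admits no `δ` at all (§1).  A statement about OUR typed `hHfac` shape and OUR `indTwo` only: it says (ψ5)'s
compatibility hypothesis is FACTORWISE and the full typed (Ind2) is not; it does not say print's (Ind2) or (ψ5) is wrong. [claim: Mochizuki2012, status: disputed]
[cite: Mochizuki2012, IUTchIII Thm. 3.11 (i) (Ind1)(Ind2) p. 154] [cite: DupuyHilado2025, §4.7, §4.9] -/
theorem not_hHfac_indTwo_of_two_le_localDeg (i₁ : Fin I.lstar) (e₁ : Fin ((i₁ : ℕ) + 1 + 1) → placesOver F₀ 2)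
    (he : ∀ b, e₁ b = e₁ 0) (hd : 2 ≤ localDeg K (I.σ.lift (e₁ 0).1)) :
    ¬ ∀ γ ∈ indTwo 2 (fun b => (I.σ.localFields 2).k (e₁ b)), ∃ δ : Π b, AddAut ((I.σ.lift (e₁ b).1).adicCompletion K),
      (∀ b, δ b ∈ AddSubgroup.closure (G := AddAut ((I.σ.lift (e₁ b).1).adicCompletion K))
        (ind1StripOf (I.σ.lift (e₁ b).1) (galoisLog (I.σ.lift (e₁ b).1)))) ∧
      ∀ z : Π b, (I.σ.localFields 2).k (e₁ b),
        (γ : PacketAlgebra 2 (fun b => (I.σ.localFields 2).k (e₁ b)) ≃ₗ[ℚ_[2]]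
            PacketAlgebra 2 (fun b => (I.σ.localFields 2).k (e₁ b))) (PiTensorProduct.tprod ℚ_[2] z) =
          PiTensorProduct.tprod ℚ_[2] (fun b => RescaledCompletion.of K 2 (I.σ.lift (e₁ b).1) (I.σ.natCast_mem_lift (e₁ b))
            (δ b ((RescaledCompletion.of K 2 (I.σ.lift (e₁ b).1) (I.σ.natCast_mem_lift (e₁ b))).symm (z b)))) := by
  obtain ⟨w, rfl⟩ : ∃ w, e₁ = fun _ => w := ⟨e₁ 0, funext he⟩
  intro h
  obtain ⟨γ, hγ, hγF⟩ := exists_mem_indTwo_const_not_factorwise I 2 w hd (i₁ : ℕ)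
  obtain ⟨δ, -, hδ⟩ := h γ hγ
  exact hγF (fun b x => RescaledCompletion.of K 2 (I.σ.lift w.1) (I.σ.natCast_mem_lift w)
    (δ b ((RescaledCompletion.of K 2 (I.σ.lift w.1) (I.σ.natCast_mem_lift w)).symm x))) hδ

end IndTwoSwap

/-! ## §3 The Gaussian instance BY NAME: at R38 §1's witness over `ℚ(√−1)`, `hHfac` fails for `H ≡ indTwo` at EVERY `(i₁, e₁)` -/

namespace DyadicWitness

open Summit.ABC.IUTFork.Joshi.PinsIsometricResidualLineGaussian

/-- **One place over `2`.**  In a quadratic number field `K ∋ s`, `s² = −1`, any two places over `2` coincide: every place over `2` has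
`e = 2`, `f = 1` (abc-iut-E-t47's `ramificationIdx_eq_two_and_inertiaDeg_eq_one`), so the fundamental identity `Σ_{w ∣ 2} e_w f_w = [K:ℚ] = 2`
(`sum_localDeg`) leaves room for exactly one.  Hence EVERY dyadic collection `e₁` over such a `K` is constant. [cite: NeukirchANT1999, Ch. I Prop. (8.2),
Ch. II Prop. (6.8)] -/
theorem placesOver_two_eq_of_finrank_two_of_sq_eq_neg_one {L : Type} [Field L] [NumberField L] (hL : Module.finrank ℚ L = 2) {s : L}
    (hs : s ^ 2 = -1) (w w' : placesOver L 2) : w = w' := by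
  classical
  have hdeg : ∀ v ∈ placesOver L 2, localDeg L v = 2 := by
    intro v hv
    have h2 : ((2 : ℕ) : 𝓞 L) ∈ v.asIdeal := by
      have h := (mem_placesOver_iff v).mp hv
      have hmem : ((2 : ℕ) : ℤ) ∈ v.asIdeal.under ℤ := by
        rw [← h.over]
        exact Ideal.mem_span_singleton_self _
      simpa using Ideal.mem_comap.mp hmem
    obtain ⟨he, hf⟩ := ramificationIdx_eq_two_and_inertiaDeg_eq_one hL hs v h2
    rw [localDeg, he, hf]
  have hsum := sum_localDeg L 2
  rw [Finset.sum_congr rfl hdeg, Finset.sum_const, smul_eq_mul, hL] at hsum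
  obtain ⟨a, ha⟩ := Finset.card_eq_one.mp (by omega : (placesOver L 2).card = 1)
  have h1 : (w : HeightOneSpectrum (𝓞 L)) = a := Finset.mem_singleton.mp (by rw [← ha]; exact w.2)
  have h2 : (w' : HeightOneSpectrum (𝓞 L)) = a := Finset.mem_singleton.mp (by rw [← ha]; exact w'.2)
  exact Subtype.ext (h1.trans h2.symm)

/-- **G1 at the R38 witness (closed theorem, no hypotheses): at EVERY `(i₁, e₁)`.**  There is a genuine Θ-volume input `I` over
`K = F₀ = ℚ(√−1) = CyclotomicField 4 ℚ` (`S = V(K)_2`, `l = 5`, every section place over `2` of local degree `2` — R38 §1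
`exists_input_of_finrank_two_of_sq_eq_neg_one` BY NAME) at which, for EVERY procession index `i₁ < ℓ⋆` and EVERY dyadic collection
`e₁ : Fin (i₁+2) → V(K)_2` (all constant: one place over `2`), R36 (ψ5)'s hypothesis `hHfac` — VERBATIM, with `H 2 _ (i₁+1) e₁ := indTwo 2 (fun b ↦ K_{e̲₁ b})` —
is FALSE: the full typed (Ind2) does not act factorwise through the (Ind1)-strip closures (§2).  The instance «`H ≡ indTwo` itself» of the R38 guard is
therefore EMPTY AS TYPED, not merely unexhibited; (ψ5) is calibrated on factorwise sub-families of (Ind2) (`⊥` R38, strip-moves `H⋆` R38b, any `H ≤ indTwo`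
satisfying `hHfac`).  Empty-binder ≠ refuted; discharges nothing; no side taken. [claim: Mochizuki2012, status: disputed]
[cite: Mochizuki2012, IUTchIII Thm. 3.11 (i) (Ind1)(Ind2) p. 154; Cor. 3.12 p. 174] [cite: DupuyHilado2025, Def. 3.6.3, §4.7, §4.9] -/
theorem exists_input_not_hHfac_indTwo_gaussian :
    ∃ I : ThetaVolumeInput (CyclotomicField 4 ℚ) (CyclotomicField 4 ℚ),
      I.X.S = placesOver (CyclotomicField 4 ℚ) 2 ∧ I.X.l = 5 ∧
      (∀ w : placesOver (CyclotomicField 4 ℚ) 2, localDeg (CyclotomicField 4 ℚ) (I.σ.lift w.1) = 2) ∧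
      ∀ (i₁ : Fin I.lstar) (e₁ : Fin ((i₁ : ℕ) + 1 + 1) → placesOver (CyclotomicField 4 ℚ) 2),
        ¬ ∀ γ ∈ indTwo 2 (fun b => (I.σ.localFields 2).k (e₁ b)),
          ∃ δ : Π b, AddAut ((I.σ.lift (e₁ b).1).adicCompletion (CyclotomicField 4 ℚ)),
            (∀ b, δ b ∈ AddSubgroup.closure (G := AddAut ((I.σ.lift (e₁ b).1).adicCompletion (CyclotomicField 4 ℚ)))
              (ind1StripOf (I.σ.lift (e₁ b).1) (galoisLog (I.σ.lift (e₁ b).1)))) ∧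
            ∀ z : Π b, (I.σ.localFields 2).k (e₁ b),
              (γ : PacketAlgebra 2 (fun b => (I.σ.localFields 2).k (e₁ b)) ≃ₗ[ℚ_[2]]
                  PacketAlgebra 2 (fun b => (I.σ.localFields 2).k (e₁ b))) (PiTensorProduct.tprod ℚ_[2] z) =
                PiTensorProduct.tprod ℚ_[2] (fun b => RescaledCompletion.of (CyclotomicField 4 ℚ) 2 (I.σ.lift (e₁ b).1) (I.σ.natCast_mem_lift (e₁ b))
                  (δ b ((RescaledCompletion.of (CyclotomicField 4 ℚ) 2 (I.σ.lift (e₁ b).1) (I.σ.natCast_mem_lift (e₁ b))).symm (z b)))) := by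
  obtain ⟨hK, s, hs⟩ := cyclotomicField_four_finrank_and_sq
  obtain ⟨I, hS, hl, hd⟩ := exists_input_of_finrank_two_of_sq_eq_neg_one hK hs
  refine ⟨I, hS, hl, hd, fun i₁ e₁ => ?_⟩
  exact IndTwoSwap.not_hHfac_indTwo_of_two_le_localDeg I i₁ e₁
    (fun b => placesOver_two_eq_of_finrank_two_of_sq_eq_neg_one hK hs _ _) (hd (e₁ 0)).ge

end DyadicWitness

end ThetaVolumeInput

end Literature.IUT.LogVolume

end
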